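import Summits.HodgeConjecture.HodgeConjecture.Theorems.CyclicUnitaryPowersFiveFacts
import Literature.AlgebraicGeometry.HodgeTheory.CyclicCoverUniversalFamily
import Literature.AlgebraicGeometry.HodgeTheory.UnitaryReflectionGroupZariskiDenseHolds
import Literature.AlgebraicGeometry.HodgeTheory.CyclicCoverDeckInvariantsTransfer

/-!
# Crux K1 `VeryGeneralDeckCommutatorsInHg` and the rung leaf modulo THREE PRINT STATEMENTS of minimal content:
# the Picard–Lefschetz package (CT99 §§3, 6, 7), the eigen-Hodge numbers (CT99 §5) and the CDK cover
# (route `CyclicUnitaryPowers`, items stmt-HodgeConjecture-19544 / 19543)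

Prover seat `hodge-nonav-prover-Bx` (g7), cell `hodge-nonav`, 2026-08-28. Landed `--supports stmt-HodgeConjecture-19544`;
sorry-free, no definition, no new named fact. CONDITIONAL results; nothing here says HC ∕ HC_AV is proved; rung F-H1
is not moved.

The registered skeleton of the crux binds FIVE Carlson–Toledo / Hodge-locus facts
(`CyclicUnitaryPowersFiveFacts.veryGeneralDeckCommutatorsInHg_of_five_facts`: the family `nonempty_carlsonToledoFamily`,
the invariant line CT1 `carlsonToledo1999_finrank_eigenspace_deck_one`, the eigen-Hodge numbers CT2
`carlsonToledo1999_finrank_eigenspace_inf_hodgePiece`, the density theorem CT71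
`carlsonToledo1999_unitaryReflection_zariskiDense`, the CDK cover `cmsp_nonHodgeGenericPoints_countable_algebraic_cover`).
Three of them are now DISCHARGED or REDUCED by tree theorems:

* the family is CONSTRUCTED — `nonempty_carlsonToledoFamily_of_cyclicReflectionSystem` (seat Ax g4) reduces it to the
  Picard–Lefschetz package `carlsonToledo1999_cyclicReflectionSystem`;
* CT71 is the theorem `carlsonToledo1999_unitaryReflection_zariskiDense_holds` (seat Bx g6);
* **CT1 is the theorem `carlsonToledo1999_finrank_eigenspace_deck_one_holds`** (seat Bx g7, this generation:
  the transfer `H²(X_F(ℂ); ℚ)^{μ_p} ≅ H²(ℙ²(ℂ); ℚ)` for the semi-free deck action, Bredon II.19.2 in the tree's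
  proved form `OrbitMap.transfer_of_semifree`, file `HodgeTheory/CyclicCoverDeckInvariantsTransfer`).

Hence:

* `veryGeneralDeckCommutatorsInHg_of_three_print_facts` — **K1 ⟸ {`carlsonToledo1999_cyclicReflectionSystem`
  (CT99 §3, §6 Prop., §7 last ¶), `carlsonToledo1999_finrank_eigenspace_inf_hodgePiece` (CT99 §5: the eigen-Hodge
  numbers of the cyclic covers of the plane, `= dim R_f^{(q+1)p−3−i}`), `cmsp_nonHodgeGenericPoints_countable_algebraic_cover`
  (CMSP §15.3 with Cattani–Deligne–Kaplan 1995)}**;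
* `cyclicSurfacePowersHodge_of_three_print_facts` — the rung leaf `CyclicSurfacePowersHodge` likewise.

Compared with `CyclicUnitaryPowersThreeFactsPL` (seat Ax g5: {PL package, Griffiths' residue-kernel package
`Griffiths1969_residueKernel_eq_jacobianIdeal`, CDK}), Griffiths' four-clause residue package in all dimensions is
replaced by the single print statement it was used for, the eigen-Hodge numbers CT2 (which it implies:
`CyclicUnitaryPowersDeckHodgeOfGriffiths.carlsonToledo1999_finrank_eigenspace_inf_hodgePiece_of_residueKernel`) — the
invariant line CT1, formerly also read off Griffiths' residues, no longer needs them. The two floors are thus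
{PL, Griffiths, CDK} and {PL, CT2, CDK} with CT2 ⟸ Griffiths; the second is pointwise weaker.

## References

* [CarlsonToledo1999] J. A. Carlson, D. Toledo, Discriminant complements and kernels of monodromy
  representations, Duke Math. J. 97 (1999), §2, §3, §5, §6 Proposition, §7 (last paragraph and Thm. 7.1).
* [CattaniDeligneKaplan1995] E. Cattani, P. Deligne, A. Kaplan, On the locus of Hodge classes, J. Amer. Math.
  Soc. 8 (1995), Thm. 1.1, Cor. 1.2.
* [Bredon1997] G. E. Bredon, *Sheaf Theory*, 2nd ed., GTM 170 (1997), II Thm. 19.2.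
-/

noncomputable section

open Literature.AlgebraicGeometry.Motives Literature.AlgebraicGeometry.HodgeTheory

-- mandated namespace `Summit.HodgeConjecture.HodgeConjecture.Theorems` trips `linter.dupNamespace` (off tree-wide)
set_option linter.dupNamespace false

namespace Summit.HodgeConjecture.HodgeConjecture.Theorems.CyclicUnitaryPowersThreePrintFacts

/-- **Crux K1 `VeryGeneralDeckCommutatorsInHg` modulo THREE print statements** — the Picard–Lefschetz package of
the family of cyclic covers of the plane (`carlsonToledo1999_cyclicReflectionSystem`, CT §3, §6, §7; the family is
constructed), the eigen-Hodge numbers of the cyclic covers (`carlsonToledo1999_finrank_eigenspace_inf_hodgePiece`,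
CT §5) and the Cattani–Deligne–Kaplan cover of the non-Hodge-generic points; the invariant line (CT §2) and the
density theorem (CT Thm. 7.1) enter as the tree theorems `carlsonToledo1999_finrank_eigenspace_deck_one_holds`,
`carlsonToledo1999_unitaryReflection_zariskiDense_holds`. CONDITIONAL; nothing here says HC ∕ HC_AV is proved.
[cite: CarlsonToledo1999, §2, §3, §5, §6 Proposition, §7 last paragraph and Thm. 7.1]
[cite: CattaniDeligneKaplan1995, Thm. 1.1 and Cor. 1.2] -/
theorem veryGeneralDeckCommutatorsInHg_of_three_print_facts
    (hPL : carlsonToledo1999_cyclicReflectionSystem)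
    (hCT2 : carlsonToledo1999_finrank_eigenspace_inf_hodgePiece)
    (hCDK : cmsp_nonHodgeGenericPoints_countable_algebraic_cover) :
    Summit.HodgeConjecture.HodgeConjecture.Theses.CyclicUnitaryPowers.VeryGeneralDeckCommutatorsInHg :=
  CyclicUnitaryPowersFiveFacts.veryGeneralDeckCommutatorsInHg_of_five_facts
    (nonempty_carlsonToledoFamily_of_cyclicReflectionSystem hPL)
    carlsonToledo1999_finrank_eigenspace_deck_one_holds @hCT2
    carlsonToledo1999_unitaryReflection_zariskiDense_holds @hCDK

/-- **The rung leaf `CyclicSurfacePowersHodge` modulo the same THREE print statements** (K1 above composed with the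
PROVED crux K2 `PowersHodgeOfDeckCommutators` and support S). CONDITIONAL; rung F-H1 not moved.
[cite: CarlsonToledo1999, §2, §3, §5, §6 Proposition, §7 last paragraph and Thm. 7.1]
[cite: CattaniDeligneKaplan1995, Thm. 1.1 and Cor. 1.2] -/
theorem cyclicSurfacePowersHodge_of_three_print_facts
    (hPL : carlsonToledo1999_cyclicReflectionSystem)
    (hCT2 : carlsonToledo1999_finrank_eigenspace_inf_hodgePiece)
    (hCDK : cmsp_nonHodgeGenericPoints_countable_algebraic_cover) :
    Summit.HodgeConjecture.HodgeConjecture.Theses.CyclicUnitaryPowers.CyclicSurfacePowersHodge :=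
  CyclicUnitaryPowersCyclicSurfacePowersHodge.cyclicSurfacePowersHodge_of_veryGeneralDeckCommutatorsInHg
    (veryGeneralDeckCommutatorsInHg_of_three_print_facts @hPL @hCT2 @hCDK)

end Summit.HodgeConjecture.HodgeConjecture.Theorems.CyclicUnitaryPowersThreePrintFacts

end
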